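import Mathlib
import Summits.CriticalPhenomena.PercolationContinuityZ3.Theorems.PercNearOneGluingNoHeavyLowerTailOddsBernstein
import HarnessLib

/-!
# THEOREM I: the level bridge for Region II — `ρ^{(c)}_{ϑ+1}(n+1)` through Region-I objects at levels `c+1`, `c+2`

Support file for the Sahi / Conjecture-P programme of route `PercNearOneGluingNoHeavy`
(`--supports stmt-CriticalPhenomena-4575`, prover prim-l12-p5 gen 38; proof note
`prim-l12-p5/PROOF-REGION-II-RENEWAL-g38.md` §3.8).  No definitions, no named facts, no sorries.

Region II of CONJECTURE A′ (g37) is BASE-II: `ρ(m) := H(−ϑ,c,m)/H(−ϑ−1,c,m)` is completely monotone (CM) for `ϑ ∈ (0,1)`,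
`0 < c < 1−ϑ` (`H(a,c,r) = ₂F₁(a,−r;c;g)`, the finite Gauss sum).  This file proves, by pure contiguous-relation algebra on top
of the g36–g38 files, the exact identities (memo §3.8 THEOREM I and (e))
  `c·H a c (n+1) = (c − a)·H a (c+1) n + a(1−g)·H (a+1) (c+1) n`                       (`hyp_shift_level`),
  `c·H a c r = g(c+r)·H (a+1) (c+1) r + (1−g)c·H (a+1) c r`                           (`hyp_psum`),
  `c(c+1)·H a c (n+1) = c(c+1)·H a (c+1) n − a g (c+1+n)·H (a+1) (c+2) n`             (`hyp_levelI`),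
and from them THEOREM I:
  `(c+ϑ+1)·ρ(n+1)·(1 + ε X(n)) = ϑ·ρ₂(n) + (c/g)·X(n)`,  `ε = c(1−g)/(g(c+ϑ+1))`,
  `ρ₂(n) = H(1−ϑ,c+2,n)/H(−ϑ,c+2,n)` (the THEOREM-H ratio at level `c+2`, CM by `hyp_inv_altSum_aux'`),
  `X(n) = (c+1)H(−ϑ,c+1,n)/((c+1+n)H(−ϑ,c+2,n))` (THEOREM X's sequence one level up)            (`hyp_rho_succ_eq`),
equivalently `(c+ϑ+1)ρ(n+1) = ϑρ₂(n) + (c/g)·V(n)` with `V := (1 − κ₂ρ₂)·X/(1+εX)`, `κ₂ = (1−g)ϑ/(c+ϑ+1)` — so that the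
single sign obstruction of Region II is isolated in `V`, an expression in PROVED Region-I objects (memo: CONJECTURE V, "`V` is
CM", numerically true at all 30 exact test points) — and the kernel BRIDGE
  `hyp_rho_succ_altSum_nonneg_of_V`:  if `V` is CM then `m ↦ ρ(m+1)` is CM  (`0 < ϑ ≤ 1`, `c > 0`, `0 < g < 1`).
-/

namespace Summit.CriticalPhenomena.PercolationContinuityZ3.Theorems

namespace HypergeomCM

open Finset MomentRatioTN
open scoped Nat

section

variable (g : ℝ) (H : ℝ → ℝ → ℕ → ℝ)
  (hH : ∀ a c r, H a c r = ∑ k ∈ range (r + 1), (r.choose k : ℝ) * (-g) ^ k *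
    ((∏ i ∈ range k, (a + i)) / (∏ i ∈ range k, (c + i))))
include hH

/-- **Shift in the argument = one level up** (memo §3.8(e)): `c·H a c (n+1) = (c − a)·H a (c+1) n + a(1−g)·H (a+1) (c+1) n`
(b-step `hyp_step` plus c-split `hyp_csplit`). -/
theorem hyp_shift_level (a c : ℝ) (hc : 0 < c) (n : ℕ) :
    c * H a c (n + 1) = (c - a) * H a (c + 1) n + a * (1 - g) * H (a + 1) (c + 1) n := by
  have h1 := hyp_step g H hH a c hc n
  have h2 := hyp_csplit g H hH a c hc n
  linear_combination h1 + h2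

/-- **Partial-sum identity** (memo (1.6) `c_m = h b_m + g S_m`, general level):
`c·H a c r = g(c+r)·H (a+1) (c+1) r + (1−g)·c·H (a+1) c r`  (from `hyp_csplit` twice and `hyp_gauss`). -/
theorem hyp_psum (a c : ℝ) (hc : 0 < c) (r : ℕ) :
    c * H a c r = g * (c + r) * H (a + 1) (c + 1) r + (1 - g) * c * H (a + 1) c r := by
  have h1 := hyp_csplit g H hH a c hc r
  have h2 := hyp_csplit g H hH (a + 1) c hc r
  have h3 := hyp_gauss g H hH r (a + 1) (c + 1) (by linarith)
  rw [show a + 1 - 1 = a by ring] at h3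
  linear_combination h1 - (1 - g) * h2 + h3

/-- **Level identity** (memo §3.8, the `B′` identity): `c(c+1)·H a c (n+1) = c(c+1)·H a (c+1) n − a·g·(c+1+n)·H (a+1) (c+2) n`. -/
theorem hyp_levelI (a c : ℝ) (hc : 0 < c) (n : ℕ) :
    c * (c + 1) * H a c (n + 1) =
      c * (c + 1) * H a (c + 1) n - a * g * (c + 1 + n) * H (a + 1) (c + 2) n := by
  have h1 := hyp_shift_level g H hH a c hc n
  have h2 := hyp_psum g H hH a (c + 1) (by linarith) n
  rw [show c + 1 + 1 = c + 2 by ring] at h2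
  linear_combination (c + 1) * h1 - a * h2

/-- **THEOREM I, cross-multiplied** (memo §3.8 (I)): with `Q2 = H(−ϑ,c+2,n)`, `Q2m = H(1−ϑ,c+2,n)`, `P = H(−ϑ,c+1,n)`:
`H(−ϑ,c,n+1)·[(c+ϑ+1) g (c+1+n) Q2 + c(1−g)(c+1) P] = H(−ϑ−1,c,n+1)·[c(c+1) P + ϑ g (c+1+n) Q2m]`
(both brackets equal `c(c+1)` times the other Gauss sum, by `hyp_levelI` and `hyp_psum`). -/
theorem hyp_levelI_cross (c : ℝ) (hc : 0 < c) (ϑ : ℝ) (n : ℕ) :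
    H (-ϑ) c (n + 1) *
        ((c + ϑ + 1) * g * (c + 1 + n) * H (-ϑ) (c + 2) n + c * (1 - g) * (c + 1) * H (-ϑ) (c + 1) n) =
      H (-ϑ - 1) c (n + 1) *
        (c * (c + 1) * H (-ϑ) (c + 1) n + ϑ * g * (c + 1 + n) * H (1 - ϑ) (c + 2) n) := by
  have iϑ := hyp_levelI g H hH (-ϑ) c hc n
  have iθ := hyp_levelI g H hH (-ϑ - 1) c hc n
  have lθ := hyp_psum g H hH (-ϑ - 1) (c + 1) (by linarith) n
  rw [show -ϑ + 1 = 1 - ϑ by ring] at iϑ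
  rw [show -ϑ - 1 + 1 = -ϑ by ring] at iθ lθ
  rw [show c + 1 + 1 = c + 2 by ring] at lθ
  linear_combination (-(H (-ϑ) c (n + 1))) * iθ - c * H (-ϑ) c (n + 1) * lθ + H (-ϑ - 1) c (n + 1) * iϑ

/-- **THEOREM I, ratio form** (memo §3.8 (I)): with `Q2 = H(−ϑ,c+2,n)`, `Q2m = H(1−ϑ,c+2,n)`, `P = H(−ϑ,c+1,n)`, `θ = ϑ+1`:
`ρ(n+1) = H(−ϑ,c,n+1)/H(−θ,c,n+1) = [c(c+1)P + ϑg(c+1+n)Q2m] / [(c+θ)g(c+1+n)Q2 + c(1−g)(c+1)P]`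
(dividing numerator and denominator by `g(c+1+n)Q2` gives the memo's form `[ϑρ₂ + (c/g)X]/((c+θ)(1+εX))`,
`ρ₂ = Q2m/Q2`, `X = (c+1)P/((c+1+n)Q2)`, `ε = c(1−g)/(g(c+θ))`). -/
theorem hyp_rho_succ_eq (hg0 : 0 < g) (hg1 : g < 1) (c : ℝ) (hc : 0 < c) (ϑ : ℝ) (h0 : 0 < ϑ) (n : ℕ) :
    H (-ϑ) c (n + 1) / H (-ϑ - 1) c (n + 1) =
      (c * (c + 1) * H (-ϑ) (c + 1) n + ϑ * g * (c + 1 + n) * H (1 - ϑ) (c + 2) n) /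
        ((c + ϑ + 1) * g * (c + 1 + n) * H (-ϑ) (c + 2) n + c * (1 - g) * (c + 1) * H (-ϑ) (c + 1) n) := by
  have key := hyp_levelI_cross g H hH c hc ϑ n
  have hQθ : 0 < H (-ϑ - 1) c (n + 1) := hyp_pos g H hH hg0.le hg1 (-ϑ - 1) (n + 1) c hc (by linarith)
  have hQ2 : 0 < H (-ϑ) (c + 2) n := hyp_pos g H hH hg0.le hg1 (-ϑ) n (c + 2) (by linarith) (by linarith)
  have hP : 0 < H (-ϑ) (c + 1) n := hyp_pos g H hH hg0.le hg1 (-ϑ) n (c + 1) (by linarith) (by linarith)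
  have hden : 0 < (c + ϑ + 1) * g * (c + 1 + n) * H (-ϑ) (c + 2) n + c * (1 - g) * (c + 1) * H (-ϑ) (c + 1) n := by
    have h1' : 0 < (c + ϑ + 1) * g * (c + 1 + n) * H (-ϑ) (c + 2) n := by positivity
    have h2' : 0 ≤ c * (1 - g) * (c + 1) * H (-ϑ) (c + 1) n :=
      mul_nonneg (mul_nonneg (mul_nonneg hc.le (by linarith)) (by linarith)) hP.le
    linarith
  rw [div_eq_div_iff hQθ.ne' hden.ne']
  linear_combination key

end

/-- **THE BRIDGE** (memo §3.8(f), §8(B4)).  Let `0 < g < 1`, `c > 0`, `0 < ϑ ≤ 1`, `θ = ϑ+1`, and write (level `c+1`, `c+2` Gauss sums)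
`P(m) = H(−ϑ,c+1,m)`, `Q2(m) = H(−ϑ,c+2,m)`, `Q2m(m) = H(1−ϑ,c+2,m)`, `D(m) = (c+θ)g(c+1+m)Q2(m) + c(1−g)(c+1)P(m)` and
`V(m) := g(c+1)·P(m)·((c+θ)Q2(m) − (1−g)ϑ·Q2m(m)) / (Q2(m)·D(m))`  — this is the memo's `V = (1 − κ₂ρ₂)·X/(1+εX) = (1−κ₂ρ₂)/(1+ε+a′)`,
`κ₂ = (1−g)ϑ/(c+θ)`, built from PROVED Region-I objects (`ρ₂` CM by THEOREM H at level `c+2`, `a′ = a^{(c+1)}_ϑ` discrete Bernstein).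
If `V` is completely monotone (CONJECTURE V; exact numerics: CM at all 38 test points) then `m ↦ ρ(m+1) = H(−ϑ,c,m+1)/H(−θ,c,m+1)`
is completely monotone — BASE-II of CONJECTURE A′'s Region II from index 1 on — because
`ρ(m+1) = (ϑ/(c+θ))·Q2m(m)/Q2(m) + (c/(g(c+θ)))·V(m)` (THEOREM I) with both summands CM. -/
theorem hyp_rho_succ_altSum_nonneg_of_V (g : ℝ) (H : ℝ → ℝ → ℕ → ℝ)
    (hH : ∀ a c r, H a c r = ∑ k ∈ range (r + 1), (r.choose k : ℝ) * (-g) ^ k *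
      ((∏ i ∈ range k, (a + i)) / (∏ i ∈ range k, (c + i))))
    (hg0 : 0 < g) (hg1 : g < 1) (c : ℝ) (hc : 0 < c) (ϑ : ℝ) (h0 : 0 < ϑ) (h1 : ϑ ≤ 1)
    (hV : ∀ k j, 0 ≤ ∑ i ∈ range (k + 1), (-1 : ℝ) ^ i * (k.choose i : ℝ) *
      (g * (c + 1) * H (-ϑ) (c + 1) (j + i) *
          ((c + ϑ + 1) * H (-ϑ) (c + 2) (j + i) - (1 - g) * ϑ * H (1 - ϑ) (c + 2) (j + i)) /
        (H (-ϑ) (c + 2) (j + i) *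
          ((c + ϑ + 1) * g * (c + 1 + ((j + i : ℕ) : ℝ)) * H (-ϑ) (c + 2) (j + i) +
            c * (1 - g) * (c + 1) * H (-ϑ) (c + 1) (j + i)))))
    (k j : ℕ) :
    0 ≤ ∑ i ∈ range (k + 1), (-1 : ℝ) ^ i * (k.choose i : ℝ) *
      (H (-ϑ) c (j + i + 1) / H (-ϑ - 1) c (j + i + 1)) := by
  -- pointwise: ρ(m+1) = A·ρ₂(m) + B·V(m)
  have e : ∀ m : ℕ, H (-ϑ) c (m + 1) / H (-ϑ - 1) c (m + 1) =
      ϑ / (c + ϑ + 1) * (H (1 - ϑ) (c + 2) m / H (-ϑ) (c + 2) m) +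
        c / (g * (c + ϑ + 1)) *
          (g * (c + 1) * H (-ϑ) (c + 1) m *
              ((c + ϑ + 1) * H (-ϑ) (c + 2) m - (1 - g) * ϑ * H (1 - ϑ) (c + 2) m) /
            (H (-ϑ) (c + 2) m *
              ((c + ϑ + 1) * g * (c + 1 + m) * H (-ϑ) (c + 2) m + c * (1 - g) * (c + 1) * H (-ϑ) (c + 1) m))) := by
    intro m
    rw [hyp_rho_succ_eq g H hH hg0 hg1 c hc ϑ h0 m]
    have hQ2 : 0 < H (-ϑ) (c + 2) m := hyp_pos g H hH hg0.le hg1 (-ϑ) m (c + 2) (by linarith) (by linarith)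
    have hP : 0 < H (-ϑ) (c + 1) m := hyp_pos g H hH hg0.le hg1 (-ϑ) m (c + 1) (by linarith) (by linarith)
    have hden : 0 < (c + ϑ + 1) * g * (c + 1 + m) * H (-ϑ) (c + 2) m + c * (1 - g) * (c + 1) * H (-ϑ) (c + 1) m := by
      have h1' : 0 < (c + ϑ + 1) * g * (c + 1 + m) * H (-ϑ) (c + 2) m := by positivity
      have h2' : 0 ≤ c * (1 - g) * (c + 1) * H (-ϑ) (c + 1) m :=
        mul_nonneg (mul_nonneg (mul_nonneg hc.le (by linarith)) (by linarith)) hP.le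
      linarith
    have hQ2' := hQ2.ne'
    have hden' := hden.ne'
    have hg' := hg0.ne'
    have hcθ' : c + ϑ + 1 ≠ 0 := by linarith
    have n1 : (c + ϑ + 1) * H (-ϑ) (c + 2) m ≠ 0 := mul_ne_zero hcθ' hQ2'
    have n2 : g * (c + ϑ + 1) * (H (-ϑ) (c + 2) m *
        ((c + ϑ + 1) * g * (c + 1 + m) * H (-ϑ) (c + 2) m + c * (1 - g) * (c + 1) * H (-ϑ) (c + 1) m)) ≠ 0 :=
      mul_ne_zero (mul_ne_zero hg' hcθ') (mul_ne_zero hQ2' hden')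
    rw [div_mul_div_comm, div_mul_div_comm, div_add_div _ _ n1 n2, div_eq_div_iff hden' (mul_ne_zero n1 n2)]
    ring
  have hsum : (∑ i ∈ range (k + 1), (-1 : ℝ) ^ i * (k.choose i : ℝ) *
      (H (-ϑ) c (j + i + 1) / H (-ϑ - 1) c (j + i + 1))) =
      ϑ / (c + ϑ + 1) * ∑ i ∈ range (k + 1), (-1 : ℝ) ^ i * (k.choose i : ℝ) *
          (H (1 - ϑ) (c + 2) (j + i) / H (-ϑ) (c + 2) (j + i)) +
        c / (g * (c + ϑ + 1)) * ∑ i ∈ range (k + 1), (-1 : ℝ) ^ i * (k.choose i : ℝ) *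
          (g * (c + 1) * H (-ϑ) (c + 1) (j + i) *
              ((c + ϑ + 1) * H (-ϑ) (c + 2) (j + i) - (1 - g) * ϑ * H (1 - ϑ) (c + 2) (j + i)) /
            (H (-ϑ) (c + 2) (j + i) *
              ((c + ϑ + 1) * g * (c + 1 + ((j + i : ℕ) : ℝ)) * H (-ϑ) (c + 2) (j + i) +
                c * (1 - g) * (c + 1) * H (-ϑ) (c + 1) (j + i)))) := by
    rw [mul_sum, mul_sum, ← sum_add_distrib]
    refine sum_congr rfl fun i _ => ?_
    rw [e (j + i)]
    push_cast
    ring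
  rw [hsum]
  -- ρ₂ is CM at level c+2 (Region-I base case: 1 - ϑ ≤ c + 2)
  have hρ2 := (hyp_inv_altSum_aux' g H hH hg0.le hg1 (c + 2) (by linarith) ϑ h0 h1 (by linarith) 0).2 k j
  simp only [Nat.cast_zero, add_zero] at hρ2
  have hρ2' : 0 ≤ ∑ i ∈ range (k + 1), (-1 : ℝ) ^ i * (k.choose i : ℝ) *
      (H (1 - ϑ) (c + 2) (j + i) / H (-ϑ) (c + 2) (j + i)) := by
    simpa only [div_eq_mul_inv] using hρ2
  have hA : 0 ≤ ϑ / (c + ϑ + 1) := div_nonneg h0.le (by linarith)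
  have hB : 0 ≤ c / (g * (c + ϑ + 1)) := div_nonneg hc.le (mul_nonneg hg0.le (by linarith))
  have := hV k j
  positivity

end HypergeomCM

end Summit.CriticalPhenomena.PercolationContinuityZ3.Theorems
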